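import Summits.ValiantsHypothesis.ValiantsHypothesis.Theorems.LacunarySymmetroidMatrixDescartesDoorA26WallBubblingWeylTripleMoments
import Summits.ValiantsHypothesis.ValiantsHypothesis.Theorems.LacunarySymmetroidMatrixDescartesDoorA26WallBubblingWeylTripleRigidity
import Summits.ValiantsHypothesis.ValiantsHypothesis.Theorems.LacunarySymmetroidMatrixDescartesDoorA26WallBubblingLevelSelectionMulti

/-!
# Wall bubbling for `DoorA26` — WEYL TRIPLES: THE RIGIDITY DICHOTOMY (sixth slot alive ⇒ every pure class dies)

HONEST FRAMING.  Chain lemma toward `TripleStratum26` of `Cruxes/DoorA26/Lines/wall_bubbling_ConfluentDoor.lean` (rev 13; crux `DoorA26`,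
stmt-ValiantsHypothesis-19979 — OPEN, typed, never asserted).  W1 seat val-sym-door-p2 g15 (#88).  ANALYSIS in the abstract `Fin 3` frame of
#84/#85: along a sequence of levels `l`, three symmetric letters `V_l` with deviations `x_l → 0`, two symmetric letters `W^a_l, W^b_l`, a scale
`N_l > 0` dominating the first five moments `M_0..M_4` of the class `2α` and the mixed pairings `polar(W, T_i)` (`i ≤ 2`):

* **`weylTriple_dichotomy`** — it is IMPOSSIBLE that both `M_5/N_l → c₅ ≠ 0` (sixth slot alive) and `polar(W^a_l,W^b_l)/N_l → d ≠ 0` (a pure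
  class alive).  Mechanism: #84 `tripleMoment_five` makes `M_5 = o(‖G_l‖)` for the frame Gram `G_l = (polar(T_i,T_j))`, so `N_l/‖G_l‖ → 0`; then
  #84 `tripleMoment_zero…four` force `G_l/‖G_l‖ → ±K` (W1 #80's cancelling pattern, `det = −λ³ ≠ 0`), and #85 `abs_det_mul_polar_le` gives
  `|polar(W^a,W^b)| ≤ 36 N² /(|det K| ‖G‖) = o(N)`.  One compactness extraction (W2 `levelSelection_multi`).

This is the analytic half of the single-cluster theorem at the stratum [3,1,1,1] (#89/#90).  Nothing here bears on `DoorA26`, `MatrixDescartes`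
(stmt-ValiantsHypothesis-18050) or `VP ≠ VNP`; `TripleStratum26`, (W), (M) OPEN.  `--supports stmt-ValiantsHypothesis-19979 --as helper`.
[this work] the rigidity dichotomy.
-/

-- `Summit.ValiantsHypothesis.ValiantsHypothesis.…` repeats a component by the D-0017 layout
-- (single-conjunct summit), which the `dupNamespace` linter flags; the name is mandated.
set_option linter.dupNamespace false

namespace Summit.ValiantsHypothesis.ValiantsHypothesis.Theorems.LacunarySymmetroidMatrixDescartes.WallBubbling

open Finset Filter Topology
open Bubbling (polar polar_apply)
open scoped BigOperators

/-- A sequence with a non-zero limit is eventually non-zero. [folklore] -/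
theorem eventually_ne_zero_of_tendsto {u : ℕ → ℝ} {c : ℝ} (hu : Tendsto u atTop (𝓝 c)) (hc : c ≠ 0) :
    ∃ l₀, ∀ l, l₀ ≤ l → u l ≠ 0 := by
  have h : ∀ᶠ l in atTop, u l ≠ 0 := hu.eventually (isOpen_ne.mem_nhds hc)
  exact eventually_atTop.mp h

/-- Squeeze to zero from a ratio bound: `|u_l| ≤ C · r_l` eventually with `r_l → 0` ⇒ `u_l → 0`. [folklore] -/
theorem tendsto_zero_of_abs_le_mul {u r : ℕ → ℝ} (C : ℝ) (hr : Tendsto r atTop (𝓝 0))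
    (h : ∀ᶠ l in atTop, |u l| ≤ C * r l) : Tendsto u atTop (𝓝 0) := by
  have hCr : Tendsto (fun l => C * r l) atTop (𝓝 0) := by simpa using hr.const_mul C
  exact squeeze_zero_norm' (by simpa [Real.norm_eq_abs] using h) hCr

/-- **THE RIGIDITY DICHOTOMY AT A WEYL TRIPLE.**  See the module docstring. [this work] -/
theorem weylTriple_dichotomy (V : ℕ → Fin 3 → Matrix (Fin 2) (Fin 2) ℝ) (hV : ∀ l p, (V l p).IsSymm)
    (x : ℕ → Fin 3 → ℝ) (hx : ∀ p, Tendsto (fun l => x l p) atTop (𝓝 0))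
    (Wa Wb : ℕ → Matrix (Fin 2) (Fin 2) ℝ) (hWa : ∀ l, (Wa l).IsSymm) (hWb : ∀ l, (Wb l).IsSymm)
    (N : ℕ → ℝ) (hN : ∀ l, 0 < N l)
    (hhead : ∀ l, ∀ m ≤ 4, |∑ p, ∑ q, polar (V l p) (V l q) * (x l p + x l q) ^ m| ≤ N l)
    (c5 : ℝ) (hc5 : c5 ≠ 0)
    (h5 : Tendsto (fun l => (∑ p, ∑ q, polar (V l p) (V l q) * (x l p + x l q) ^ 5) / N l) atTop (𝓝 c5))
    (hmixa : ∀ l (m : ℕ), m ≤ 2 → |polar (Wa l) (∑ q, x l q ^ m • V l q)| ≤ N l)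
    (hmixb : ∀ l (m : ℕ), m ≤ 2 → |polar (∑ q, x l q ^ m • V l q) (Wb l)| ≤ N l)
    (d : ℝ) (hd : d ≠ 0) (hpure : Tendsto (fun l => polar (Wa l) (Wb l) / N l) atTop (𝓝 d)) : False := by
  classical
  -- frame, Gram, moments, elementary symmetric functions
  set T : ℕ → Fin 3 → Matrix (Fin 2) (Fin 2) ℝ := fun l i => ∑ q, x l q ^ (i : ℕ) • V l q with hT
  set G : ℕ → Fin 3 × Fin 3 → ℝ := fun l ij => polar (T l ij.1) (T l ij.2) with hG
  set M : ℕ → ℕ → ℝ := fun l m => ∑ p, ∑ q, polar (V l p) (V l q) * (x l p + x l q) ^ m with hM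
  set e1 : ℕ → ℝ := fun l => x l 0 + x l 1 + x l 2 with he1
  set e2 : ℕ → ℝ := fun l => x l 0 * x l 1 + x l 0 * x l 2 + x l 1 * x l 2 with he2
  set e3 : ℕ → ℝ := fun l => x l 0 * x l 1 * x l 2 with he3
  have hTsymm : ∀ l i, (T l i).IsSymm := by
    intro l i
    simp only [hT]
    unfold Matrix.IsSymm
    rw [Matrix.transpose_sum]
    exact Finset.sum_congr rfl fun q _ => by rw [Matrix.transpose_smul, (hV l q)]
  have hGsymm : ∀ l i j, G l (i, j) = G l (j, i) := fun l i j => Bubbling.polar_comm _ _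
  have he1lim : Tendsto e1 atTop (𝓝 0) := by simpa [he1] using ((hx 0).add (hx 1)).add (hx 2)
  have he2lim : Tendsto e2 atTop (𝓝 0) := by
    simpa [he2] using (((hx 0).mul (hx 1)).add ((hx 0).mul (hx 2))).add ((hx 1).mul (hx 2))
  have he3lim : Tendsto e3 atTop (𝓝 0) := by simpa [he3] using ((hx 0).mul (hx 1)).mul (hx 2)
  -- the moment identities of #84 in this notation
  have hT0 : ∀ l, T l 0 = ∑ q, x l q ^ 0 • V l q := fun l => rfl
  have hT1 : ∀ l, T l 1 = ∑ q, x l q ^ 1 • V l q := fun l => rfl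
  have hT2 : ∀ l, T l 2 = ∑ q, x l q ^ 2 • V l q := fun l => rfl
  have hM0 : ∀ l, M l 0 = G l (0, 0) := fun l => tripleMoment_zero (V l) (x l)
  have hM1 : ∀ l, M l 1 = 2 * G l (0, 1) := fun l => tripleMoment_one (V l) (x l)
  have hM2 : ∀ l, M l 2 = 2 * G l (0, 2) + 2 * G l (1, 1) := fun l => tripleMoment_two (V l) (x l)
  have hM3 : ∀ l, M l 3 = 6 * G l (1, 2) + 2 * (e1 l * G l (0, 2) - e2 l * G l (0, 1) + e3 l * G l (0, 0)) :=
    fun l => tripleMoment_three (V l) (x l)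
  have hM4 : ∀ l, M l 4 = 6 * G l (2, 2)
      + 2 * ((e1 l ^ 2 - e2 l) * G l (0, 2) + (e3 l - e1 l * e2 l) * G l (0, 1) + e1 l * e3 l * G l (0, 0))
      + 8 * (e1 l * G l (1, 2) - e2 l * G l (1, 1) + e3 l * G l (0, 1)) := fun l => tripleMoment_four (V l) (x l)
  have hM5 : ∀ l, M l 5 =
      2 * ((e1 l ^ 3 - 2 * e1 l * e2 l + e3 l) * G l (0, 2)
          + (e1 l * e3 l - e1 l ^ 2 * e2 l + e2 l ^ 2) * G l (0, 1)
          + (e1 l ^ 2 * e3 l - e2 l * e3 l) * G l (0, 0))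
      + 10 * ((e1 l ^ 2 - e2 l) * G l (1, 2) + (e3 l - e1 l * e2 l) * G l (1, 1) + e1 l * e3 l * G l (0, 1))
      + 20 * (e1 l * G l (2, 2) - e2 l * G l (1, 2) + e3 l * G l (0, 2)) := fun l => tripleMoment_five (V l) (x l)
  -- Step 1: `M_5 ≠ 0` eventually; shift there
  obtain ⟨l₀, hl₀⟩ := eventually_ne_zero_of_tendsto h5 hc5
  have hM5ne : ∀ l, l₀ ≤ l → M l 5 ≠ 0 := by
    intro l hl h0
    exact hl₀ l hl (by change M l 5 / N l = 0; rw [h0, zero_div])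
  -- the Gram scale `α_l = max |G_l|` is positive there
  set α : ℕ → ℝ := fun l => (univ : Finset (Fin 3 × Fin 3)).sup' Finset.univ_nonempty (fun ij => |G l ij|) with hα
  have hdomG : ∀ l ij, |G l ij| ≤ α l := fun l ij => Finset.le_sup' (fun ij => |G l ij|) (Finset.mem_univ ij)
  have hattG : ∀ l, ∃ ij, |G l ij| = α l := by
    intro l
    obtain ⟨ij, _, h⟩ := Finset.exists_mem_eq_sup' (Finset.univ_nonempty (α := Fin 3 × Fin 3)) (fun ij => |G l ij|)
    exact ⟨ij, h.symm⟩
  have hα0 : ∀ l, 0 ≤ α l := fun l => (abs_nonneg _).trans (hdomG l (0, 0))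
  have hαpos : ∀ l, l₀ ≤ l → 0 < α l := by
    intro l hl
    rcases (hα0 l).lt_or_eq with h | h
    · exact h
    · exfalso
      have hG0 : ∀ ij, G l ij = 0 := fun ij => abs_eq_zero.mp (le_antisymm (h ▸ hdomG l ij) (abs_nonneg _))
      apply hM5ne l hl
      rw [hM5 l]; simp only [hG0, mul_zero, add_zero, sub_zero]
  -- Step 2: one compactness extraction for the normalised Gram (shifted by `l₀`)
  obtain ⟨ψ, hψ, β, hβ, hβle, ⟨ij₁, hij₁⟩⟩ := levelSelection_multi (fun l ij => G (l + l₀) ij) (fun l => α (l + l₀))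
    (fun l => hαpos _ (Nat.le_add_left _ _)) (fun l ij => hdomG _ ij) (fun l => hattG _)
  -- along `σ l = ψ l + l₀`
  set σ : ℕ → ℕ := fun l => ψ l + l₀ with hσ
  have hσmono : StrictMono σ := fun a b hab => by simp only [hσ]; exact Nat.add_lt_add_right (hψ hab) _
  have hσge : ∀ l, l₀ ≤ σ l := fun l => Nat.le_add_left _ _
  have hσtop : Tendsto σ atTop atTop := hσmono.tendsto_atTop
  have hβ' : ∀ ij, Tendsto (fun l => G (σ l) ij / α (σ l)) atTop (𝓝 (β ij)) := fun ij => hβ ij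
  have hx' : ∀ p, Tendsto (fun l => x (σ l) p) atTop (𝓝 0) := fun p => (hx p).comp hσtop
  have he1' : Tendsto (fun l => e1 (σ l)) atTop (𝓝 0) := he1lim.comp hσtop
  have he2' : Tendsto (fun l => e2 (σ l)) atTop (𝓝 0) := he2lim.comp hσtop
  have he3' : Tendsto (fun l => e3 (σ l)) atTop (𝓝 0) := he3lim.comp hσtop
  have hασ : ∀ l, 0 < α (σ l) := fun l => hαpos _ (hσge l)
  have hNσ : ∀ l, 0 < N (σ l) := fun l => hN _
  -- Step 3: `M_5/α → 0` by the identity, hence `N/α → 0`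
  have hM5α : Tendsto (fun l => M (σ l) 5 / α (σ l)) atTop (𝓝 0) := by
    have hlim := ((((((he1'.pow 3).sub ((he1'.const_mul 2).mul he2')).add he3').mul (hβ' (0, 2))).add
        ((((he1'.mul he3').sub ((he1'.pow 2).mul he2')).add (he2'.pow 2)).mul (hβ' (0, 1)))).add
        ((((he1'.pow 2).mul he3').sub (he2'.mul he3')).mul (hβ' (0, 0)))).const_mul 2
    have hlim2 := (((((he1'.pow 2).sub he2').mul (hβ' (1, 2))).add ((he3'.sub (he1'.mul he2')).mul (hβ' (1, 1)))).add
        ((he1'.mul he3').mul (hβ' (0, 1)))).const_mul 10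
    have hlim3 := (((he1'.mul (hβ' (2, 2))).sub (he2'.mul (hβ' (1, 2)))).add (he3'.mul (hβ' (0, 2)))).const_mul 20
    have htot := (hlim.add hlim2).add hlim3
    simp only [zero_pow (by norm_num : 3 ≠ 0), zero_pow (by norm_num : 2 ≠ 0), mul_zero, zero_mul, sub_zero, add_zero] at htot
    refine htot.congr fun l => ?_
    rw [hM5 (σ l)]
    ring
  have hNα : Tendsto (fun l => N (σ l) / α (σ l)) atTop (𝓝 0) := by
    have h5σ : Tendsto (fun l => M (σ l) 5 / N (σ l)) atTop (𝓝 c5) := h5.comp hσtop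
    have h := hM5α.div h5σ hc5
    rw [zero_div] at h
    refine h.congr fun l => ?_
    have h1 : M (σ l) 5 ≠ 0 := hM5ne _ (hσge l)
    have h2 : N (σ l) ≠ 0 := ne_of_gt (hNσ l)
    have h3 : α (σ l) ≠ 0 := ne_of_gt (hασ l)
    simp only [Pi.div_apply]
    field_simp
  -- Step 4: the limit Gram is the cancelling pattern
  have hsmall : ∀ (u : ℕ → ℝ) (C : ℝ), (∀ l, |u l| ≤ C * N (σ l)) → Tendsto (fun l => u l / α (σ l)) atTop (𝓝 0) := by
    intro u C hu
    refine tendsto_zero_of_abs_le_mul C hNα (Filter.Eventually.of_forall fun l => ?_)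
    rw [abs_div, abs_of_pos (hασ l), div_le_iff₀ (hασ l)]
    have hα1 : α (σ l) ≠ 0 := ne_of_gt (hασ l)
    have heq : C * (N (σ l) / α (σ l)) * α (σ l) = C * N (σ l) := by
      field_simp
    rw [heq]
    exact hu l
  have hβ00 : β (0, 0) = 0 := by
    refine tendsto_nhds_unique (hβ' (0, 0)) ?_
    refine (hsmall (fun l => G (σ l) (0, 0)) 1 fun l => ?_)
    rw [← hM0, one_mul]; exact hhead _ 0 (by norm_num)
  have hβ01 : β (0, 1) = 0 := by
    have h : Tendsto (fun l => (2 * G (σ l) (0, 1)) / α (σ l)) atTop (𝓝 0) :=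
      hsmall (fun l => 2 * G (σ l) (0, 1)) 1 fun l => by rw [← hM1, one_mul]; exact hhead _ 1 (by norm_num)
    have h2 : Tendsto (fun l => G (σ l) (0, 1) / α (σ l)) atTop (𝓝 0) := by
      have := h.const_mul (1 / 2); simp only [mul_zero] at this
      exact this.congr fun l => by ring
    exact tendsto_nhds_unique (hβ' (0, 1)) h2
  have hβ0211 : β (0, 2) + β (1, 1) = 0 := by
    have h : Tendsto (fun l => (2 * G (σ l) (0, 2) + 2 * G (σ l) (1, 1)) / α (σ l)) atTop (𝓝 0) :=
      hsmall _ 1 fun l => by rw [← hM2, one_mul]; exact hhead _ 2 (by norm_num)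
    have h2 : Tendsto (fun l => G (σ l) (0, 2) / α (σ l) + G (σ l) (1, 1) / α (σ l)) atTop (𝓝 0) := by
      have := h.const_mul (1 / 2); simp only [mul_zero] at this
      exact this.congr fun l => by ring
    have := tendsto_nhds_unique ((hβ' (0, 2)).add (hβ' (1, 1))) h2
    exact this
  have hβ12 : β (1, 2) = 0 := by
    -- `6 G₁₂ = M₃ − (e-terms)`, the e-terms are `o(α)`
    have hR : Tendsto (fun l => (2 * (e1 (σ l) * G (σ l) (0, 2) - e2 (σ l) * G (σ l) (0, 1) + e3 (σ l) * G (σ l) (0, 0))) / α (σ l))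
        atTop (𝓝 0) := by
      have h := (((he1'.mul (hβ' (0, 2))).sub (he2'.mul (hβ' (0, 1)))).add (he3'.mul (hβ' (0, 0)))).const_mul 2
      simp only [zero_mul, sub_zero, add_zero, mul_zero] at h
      refine h.congr fun l => ?_
      ring
    have hM3α : Tendsto (fun l => M (σ l) 3 / α (σ l)) atTop (𝓝 0) :=
      hsmall _ 1 fun l => by rw [one_mul]; exact hhead _ 3 (by norm_num)
    have h : Tendsto (fun l => G (σ l) (1, 2) / α (σ l)) atTop (𝓝 0) := by
      have := (hM3α.sub hR).const_mul (1 / 6); simp only [sub_zero, mul_zero] at this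
      refine this.congr fun l => ?_
      rw [hM3]; ring
    exact tendsto_nhds_unique (hβ' (1, 2)) h
  have hβ22 : β (2, 2) = 0 := by
    have hR : Tendsto (fun l => (2 * ((e1 (σ l) ^ 2 - e2 (σ l)) * G (σ l) (0, 2) + (e3 (σ l) - e1 (σ l) * e2 (σ l)) * G (σ l) (0, 1)
        + e1 (σ l) * e3 (σ l) * G (σ l) (0, 0))
        + 8 * (e1 (σ l) * G (σ l) (1, 2) - e2 (σ l) * G (σ l) (1, 1) + e3 (σ l) * G (σ l) (0, 1))) / α (σ l)) atTop (𝓝 0) := by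
      have h := (((((he1'.pow 2).sub he2').mul (hβ' (0, 2))).add ((he3'.sub (he1'.mul he2')).mul (hβ' (0, 1)))).add
        ((he1'.mul he3').mul (hβ' (0, 0)))).const_mul 2
      have h' := (((he1'.mul (hβ' (1, 2))).sub (he2'.mul (hβ' (1, 1)))).add (he3'.mul (hβ' (0, 1)))).const_mul 8
      have htot := h.add h'
      simp only [zero_pow (by norm_num : 2 ≠ 0), zero_mul, sub_zero, add_zero, mul_zero] at htot
      refine htot.congr fun l => ?_
      ring
    have hM4α : Tendsto (fun l => M (σ l) 4 / α (σ l)) atTop (𝓝 0) :=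
      hsmall _ 1 fun l => by rw [one_mul]; exact hhead _ 4 (by norm_num)
    have h : Tendsto (fun l => G (σ l) (2, 2) / α (σ l)) atTop (𝓝 0) := by
      have := (hM4α.sub hR).const_mul (1 / 6); simp only [sub_zero, mul_zero] at this
      refine this.congr fun l => ?_
      rw [hM4]; ring
    exact tendsto_nhds_unique (hβ' (2, 2)) h
  have hβsymm : ∀ i j, β (i, j) = β (j, i) := by
    intro i j
    refine tendsto_nhds_unique (hβ' (i, j)) ((hβ' (j, i)).congr fun l => ?_)
    rw [hGsymm (σ l) j i]
  -- `λ = β₁₁ ≠ 0`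
  set lam : ℝ := β (1, 1) with hlam
  have hβ02 : β (0, 2) = -lam := by rw [hlam]; linarith
  have hlam0 : lam ≠ 0 := by
    intro h0
    have hall : ∀ ij : Fin 3 × Fin 3, β ij = 0 := by
      rintro ⟨i, j⟩
      fin_cases i <;> fin_cases j
      · exact hβ00
      · exact hβ01
      · simpa [h0] using hβ02
      · rw [hβsymm]; exact hβ01
      · exact h0
      · exact hβ12
      · rw [hβsymm]; simpa [h0] using hβ02
      · rw [hβsymm]; exact hβ12
      · exact hβ22
    have := hij₁; rw [hall ij₁, abs_zero] at this; exact zero_ne_one this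
  -- Step 5: the determinant of the normalised Gram stays away from zero
  set Bm : ℕ → Matrix (Fin 3) (Fin 3) ℝ := fun l => Matrix.of fun i j : Fin 3 => G (σ l) (i, j) / α (σ l) with hBm
  set Binf : Matrix (Fin 3) (Fin 3) ℝ := Matrix.of fun i j : Fin 3 => β (i, j) with hBinf
  have hBlim : Tendsto Bm atTop (𝓝 Binf) := by
    refine tendsto_pi_nhds.mpr fun i => tendsto_pi_nhds.mpr fun j => ?_
    simp only [hBm, hBinf, Matrix.of_apply]
    exact hβ' (i, j)
  have hdetlim : Tendsto (fun l => (Bm l).det) atTop (𝓝 Binf.det) := (continuous_id.matrix_det.tendsto Binf).comp hBlim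
  have hdetinf : Binf.det = -lam ^ 3 := by
    rw [Matrix.det_fin_three]
    simp only [hBinf, Matrix.of_apply, hβ00, hβ01, hβ02, hβ12, hβ22, ← hβsymm 0 1, ← hβsymm 0 2, ← hβsymm 1 2]
    rw [← hlam]
    ring
  have hdetinf_ne : Binf.det ≠ 0 := by rw [hdetinf]; exact neg_ne_zero.mpr (pow_ne_zero 3 hlam0)
  obtain ⟨l₁, hl₁⟩ : ∃ l₁, ∀ l, l₁ ≤ l → |Binf.det| / 2 ≤ |(Bm l).det| := by
    have hpos : 0 < |Binf.det| / 2 := by positivity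
    have h := (continuous_abs.tendsto _).comp hdetlim
    have hev : ∀ᶠ l in atTop, |Binf.det| / 2 ≤ |(Bm l).det| := by
      have := h.eventually (Ici_mem_nhds (show |Binf.det| / 2 < |Binf.det| by linarith))
      exact this
    exact eventually_atTop.mp hev
  -- `det G = α³ det B`
  have hGmat : ∀ l, (Matrix.of fun i j : Fin 3 => polar (T (σ l) i) (T (σ l) j)) = α (σ l) • Bm l := by
    intro l; ext i j
    simp only [hBm, Matrix.of_apply, Matrix.smul_apply, smul_eq_mul]
    rw [mul_div_cancel₀ _ (ne_of_gt (hασ l))]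
  have hdetG : ∀ l, (Matrix.of fun i j : Fin 3 => polar (T (σ l) i) (T (σ l) j)).det = α (σ l) ^ 3 * (Bm l).det := by
    intro l; rw [hGmat, Matrix.det_smul, Fintype.card_fin]
  -- Step 6: rigidity kills the pure pairing
  have hbound : ∀ l, l₁ ≤ l → |polar (Wa (σ l)) (Wb (σ l))| ≤ 36 / |Binf.det| * (N (σ l) * (N (σ l) / α (σ l))) := by
    intro l hl
    have hrig := abs_det_mul_polar_le (T (σ l)) (hTsymm (σ l)) (Wa (σ l)) (Wb (σ l)) (hWa _) (hWb _)
      (α (σ l)) (N (σ l)) (N (σ l)) (fun k k' => hdomG (σ l) (k, k'))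
      (fun i => by
        have := hmixa (σ l) (i : ℕ) (by have := i.isLt; omega)
        simpa [hT] using this)
      (fun j => by
        have := hmixb (σ l) (j : ℕ) (by have := j.isLt; omega)
        simpa [hT] using this)
    rw [hdetG, abs_mul, abs_pow, abs_of_pos (hασ l)] at hrig
    have hαl := hασ l
    have hdetB : |Binf.det| / 2 ≤ |(Bm l).det| := hl₁ l hl
    have hD0 : 0 < |Binf.det| := abs_pos.mpr hdetinf_ne
    -- `α³ |det B| |p| ≤ 18 α² N²` ⇒ `|p| ≤ 18 N²/(α |det B|) ≤ 36 N² /(α |det Binf|)`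
    have h1 : α (σ l) ^ 3 * (|Binf.det| / 2) * |polar (Wa (σ l)) (Wb (σ l))| ≤ 18 * α (σ l) ^ 2 * N (σ l) * N (σ l) := by
      calc α (σ l) ^ 3 * (|Binf.det| / 2) * |polar (Wa (σ l)) (Wb (σ l))|
          ≤ α (σ l) ^ 3 * |(Bm l).det| * |polar (Wa (σ l)) (Wb (σ l))| := by gcongr
        _ ≤ 18 * α (σ l) ^ 2 * N (σ l) * N (σ l) := hrig
    rw [div_mul_eq_mul_div, le_div_iff₀ hD0]
    have hα3 : 0 < α (σ l) ^ 3 := pow_pos hαl 3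
    have key : |polar (Wa (σ l)) (Wb (σ l))| * |Binf.det| * α (σ l) ≤ 36 * (N (σ l) * N (σ l)) := by
      nlinarith [h1, hαl, hD0, abs_nonneg (polar (Wa (σ l)) (Wb (σ l)))]
    calc |polar (Wa (σ l)) (Wb (σ l))| * |Binf.det|
        = (|polar (Wa (σ l)) (Wb (σ l))| * |Binf.det| * α (σ l)) / α (σ l) := by field_simp
      _ ≤ 36 * (N (σ l) * N (σ l)) / α (σ l) := by gcongr
      _ = 36 * (N (σ l) * (N (σ l) / α (σ l))) := by ring
  have hzero : Tendsto (fun l => polar (Wa (σ l)) (Wb (σ l)) / N (σ l)) atTop (𝓝 0) := by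
    refine tendsto_zero_of_abs_le_mul (36 / |Binf.det|) hNα (eventually_atTop.mpr ⟨l₁, fun l hl => ?_⟩)
    rw [abs_div, abs_of_pos (hNσ l), div_le_iff₀ (hNσ l)]
    calc |polar (Wa (σ l)) (Wb (σ l))| ≤ 36 / |Binf.det| * (N (σ l) * (N (σ l) / α (σ l))) := hbound l hl
      _ = 36 / |Binf.det| * (N (σ l) / α (σ l)) * N (σ l) := by ring
  have hdσ : Tendsto (fun l => polar (Wa (σ l)) (Wb (σ l)) / N (σ l)) atTop (𝓝 d) := hpure.comp hσtop
  exact hd (tendsto_nhds_unique hdσ hzero)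

end Summit.ValiantsHypothesis.ValiantsHypothesis.Theorems.LacunarySymmetroidMatrixDescartes.WallBubbling
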